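import Summits.NavierStokesRegularity.TurbBounds.ShearTailRule
import Summits.NavierStokesRegularity.TurbBounds.Certs.S1000.Scalars

/-!
# Certificate S1000 (CERTIFIED.md row R1 = C1′, the HEADLINE shear certificate) — the recorded tail slacks ARE the rule's values

`Certs.S1000.Scalars.kappaSlack` (14 literals copied from the container, with `kappaSlack_nonneg`) equals, in the kernel, the list produced by the
tail-slack RULE of rbsdp SPEC 2.2/2.6/2.7 (`ShearTailRule.kappaSlackList`) at the row's data: Γx = `Scalars.Gx`, π_hi = 5419351/1725033 (container
params.pi_hi), π_lo = `Scalars.piLo`, T = ‖φ̂‖₁ = `Scalars.T`, P = 20, N_m = `Scalars.Nm`. Hence the tail-lemma hypothesis `A_m − κ̃_m‖φ̂‖₁ ≥ 0` of every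
certified mode holds for the RULE's value, not merely for a recorded literal. Pure theorem file (pub-turb-shear gen 5).
HONEST FRAMING: rigorous bounds for the stated PDE and boundary conditions; no claim about physical turbulence beyond the bound.
-/

namespace Summit.NavierStokesRegularity.TurbBounds.Certs.S1000

/-- **R1: recorded κ-slacks = rule values** (modes 1 … 14; P = 20). -/
theorem kappaSlack_rule :
    Scalars.kappaSlack = ShearTailRule.kappaSlackList Scalars.Gx (5419351 / 1725033) Scalars.piLo Scalars.T 20 Scalars.Nm := by
  decide +kernel

/-- Hence the tail-lemma hypothesis holds for the rule's value at every certified mode. -/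
theorem kappaSlack_rule_nonneg :
    ∀ x ∈ ShearTailRule.kappaSlackList Scalars.Gx (5419351 / 1725033) Scalars.piLo Scalars.T 20 Scalars.Nm, 0 ≤ x := by
  rw [← kappaSlack_rule]; exact Scalars.kappaSlack_nonneg

end Summit.NavierStokesRegularity.TurbBounds.Certs.S1000
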